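import Summits.ResolutionOfSingularities.ResolutionOfSingularities.Theorems.MarkedTransferCampaignW46MohWindowSurfaceResidualOrder
import HarnessLib

/-!
# [OURS · L1 W4.6 rung (iii-2), piece (T)] Surface Moh window — the RESIDUAL ORDER of a coefficient presentation, its transport,
# and the chart identities of the transform (cell res-hironaka, LADDER-RESOLUTION rung L, D-0089; unit res-L1-s46-pv-12 carried by
# res-D-pv-050; host MarkedTransfer, `--supports stmt-ResolutionOfSingularities-16155 --as helper`)

HONEST FRAMING. Nothing here is a statement of H. Hironaka's manuscript [Hironaka2017] and nothing here asserts that any statement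
of it holds. Ring-level bookkeeping for the termination proof of `CampaignW46.MohWindowSurfaceTameTerminates` (statement file
`…CampaignW46MohWindowSurface.lean` §5–§6, res-L1-type-o1): the per-point value of the descending multiset is res-L1-type-o1's
INTRINSIC `CampaignW46.residualOrder` (§6), and this file records (i) that a COEFFICIENT window presentation
`I = (z^p + Σ_{j≤d} a_j x^{d−j} y^j)` (a unit among the `a_j`, `p < d < 2p`) has `residualOrder p R I = d` — by res-D-pv-008 AS
res-L1-s46-pv-14's uniqueness theorem `isGreatest_window_exponent` (`…MohWindowSurfaceResidualOrder.lean`, piece (H)) after checking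
`Σ a_j x^{d−j} y^j ∈ (x,y)^d ∖ 𝔪^{d+1}` (quasi-regularity); (ii) that `residualOrder` is transported by ring isomorphisms (off the
centre a blow-up is an isomorphism on stalks); (iii) the chart identities `z^p + F ↦ c_i^p · (e₂^p + c_i^{d−p} f̃)` / `c₂^p · unit` of
the pulled-back window equation and the colon `((t^p g) : (t)^p) = (g)`. AI-written; AI review is weaker than expert review.
No `sorry`; axioms standard. [folklore]
-/

noncomputable section

set_option linter.dupNamespace false -- mandated namespace of this single-conjunct summit

namespace Summit.ResolutionOfSingularities.ResolutionOfSingularities.Theorems.CampaignW46.MohWindowSurface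

open IsLocalRing MvPolynomial
open Literature.AlgebraicGeometry.Resolution
open Summit.ResolutionOfSingularities.ResolutionOfSingularities.Theorems.CampaignW46.MohWindowSurfaceResidualOrder

universe u

variable {R : Type u} [CommRing R]

/-! ## 1. The coefficient form `Σ a_j x^{d−j} y^j` -/

/-- The coefficient form lies in `(x, y)^d`. [folklore] -/
theorem coeffForm_mem_span_pow (x y : R) (d : ℕ) (a : ℕ → R) :
    ∑ j ∈ Finset.range (d + 1), a j * x ^ (d - j) * y ^ j ∈ Ideal.span {x, y} ^ d := by
  refine Ideal.sum_mem _ fun j hj => ?_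
  have hjd : j ≤ d := Nat.lt_succ_iff.mp (Finset.mem_range.mp hj)
  have hx : x ∈ Ideal.span ({x, y} : Set R) := Ideal.subset_span (Set.mem_insert _ _)
  have hy : y ∈ Ideal.span ({x, y} : Set R) := Ideal.subset_span (Set.mem_insert_of_mem _ (Set.mem_singleton _))
  have h1 : x ^ (d - j) * y ^ j ∈ Ideal.span {x, y} ^ d := by
    have := Ideal.mul_mem_mul (Ideal.pow_mem_pow hx (d - j)) (Ideal.pow_mem_pow hy j)
    rwa [← pow_add, Nat.sub_add_cancel hjd] at this
  rw [mul_assoc]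
  exact Ideal.mul_mem_left _ _ h1

/-- **A coefficient form with a unit coefficient is not in `𝔪^{d+1}`** (quasi-regularity of the regular system of parameters
`(x, y, z)`, through res-D-pv-008's `coeff_mem_of_eval_mem_pow_succ`). [cite: Matsumura1987, Thm. 16.2 (i)] -/
theorem coeffForm_not_mem_pow_succ [IsLocalRing R] (hR : IsRegularLocalRing R) (h3 : (maximalIdeal R).spanFinrank = 3)
    {x y z : R} (hxyz : Ideal.span {x, y, z} = maximalIdeal R) {d : ℕ} {a : ℕ → R} (hunit : ∃ j ≤ d, IsUnit (a j)) :
    ∑ j ∈ Finset.range (d + 1), a j * x ^ (d - j) * y ^ j ∉ maximalIdeal R ^ (d + 1) := by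
  classical
  intro hmem
  obtain ⟨j₀, hj₀, hu⟩ := hunit
  -- the form `F = Σ a_j X^{d-j} Y^j`
  set m : ℕ → (Fin 3 →₀ ℕ) := fun j => Finsupp.single 0 (d - j) + Finsupp.single 1 j with hm
  set F : MvPolynomial (Fin 3) R := ∑ j ∈ Finset.range (d + 1), monomial (m j) (a j) with hF
  have hdeg : ∀ j ∈ Finset.range (d + 1), (m j).degree = d := fun j hj => by
    have hjd : j ≤ d := Nat.lt_succ_iff.mp (Finset.mem_range.mp hj)
    simp only [hm, map_add, Finsupp.degree_single]
    omega
  have hhom : F.IsHomogeneous d := by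
    rw [hF]
    exact IsHomogeneous.sum _ _ _ fun j hj => isHomogeneous_monomial _ (hdeg j hj)
  have hev : eval ![x, y, z] F = ∑ j ∈ Finset.range (d + 1), a j * x ^ (d - j) * y ^ j := by
    rw [hF, map_sum]
    refine Finset.sum_congr rfl fun j _ => ?_
    rw [eval_monomial]
    have hprod : (m j).prod (fun i k => (![x, y, z] : Fin 3 → R) i ^ k) = x ^ (d - j) * y ^ j := by
      simp only [hm]
      rw [Finsupp.prod_add_index' (h := fun i k => (![x, y, z] : Fin 3 → R) i ^ k) (fun _ => pow_zero _)
        (fun _ _ _ => pow_add _ _ _)]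
      rw [Finsupp.prod_single_index (h := fun i k => (![x, y, z] : Fin 3 → R) i ^ k) (pow_zero _),
        Finsupp.prod_single_index (h := fun i k => (![x, y, z] : Fin 3 → R) i ^ k) (pow_zero _)]
      rfl
    rw [hprod]
    ring
  have key := coeff_mem_of_eval_mem_pow_succ hR h3 hxyz hhom (by rw [hev]; exact hmem) (m j₀)
  -- the coefficient of `F` at `m j₀` is `a j₀`
  have hinj : ∀ j, m j = m j₀ → j = j₀ := fun j h => by
    have := congrArg (fun f => f 1) h
    simpa [hm, Finsupp.single_apply] using this
  have hcoeff : F.coeff (m j₀) = a j₀ := by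
    rw [hF, coeff_sum]
    simp only [coeff_monomial]
    rw [Finset.sum_eq_single j₀]
    · rw [if_pos rfl]
    · intro j _ hj
      rw [if_neg (fun h => hj (hinj j h))]
    · intro h
      exact absurd (Finset.mem_range.mpr (Nat.lt_succ_of_le hj₀)) h
  rw [hcoeff] at key
  exact (maximalIdeal.isMaximal R).ne_top (Ideal.eq_top_of_isUnit_mem _ key hu)

/-- **The residual order of a coefficient window presentation is its exponent `d`** (characteristic `p`, `p < d < 2p`):
res-D-pv-008's `isGreatest_window_exponent` applied to `f = Σ a_j x^{d−j} y^j ∈ (x, y)^d ∖ 𝔪^{d+1}`. [folklore] -/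
theorem residualOrder_coeff [IsLocalRing R] (p : ℕ) [Fact p.Prime] [CharP R p] (hR : IsRegularLocalRing R)
    (h3 : (maximalIdeal R).spanFinrank = 3) {x y z : R} (hxyz : Ideal.span {x, y, z} = maximalIdeal R) {d : ℕ}
    (hpd : p < d) (hd2 : d < 2 * p) {a : ℕ → R} (hunit : ∃ j ≤ d, IsUnit (a j)) :
    residualOrder p R (Ideal.span {z ^ p + ∑ j ∈ Finset.range (d + 1), a j * x ^ (d - j) * y ^ j}) = d := by
  have hG := isGreatest_window_exponent p hR h3 hxyz hpd hd2 (coeffForm_mem_span_pow x y d a)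
    (coeffForm_not_mem_pow_succ hR h3 hxyz hunit) (z := z)
  unfold residualOrder
  apply le_antisymm
  · exact iSup₂_le fun n hn => by exact_mod_cast hG.2 hn
  · exact le_iSup₂_of_le d hG.1 le_rfl

/-! ## 2. Transport of the residual order along ring isomorphisms -/

/-- One direction of the transport: an admissible `(w, n)` for `I` gives one for `e(I)`. [folklore] -/
theorem residualOrder_aux [IsLocalRing R] {S : Type u} [CommRing S] [IsLocalRing S] (b : ℕ) (e : R ≃+* S)
    {I : Ideal R} {n : ℕ} (h : ∃ w ∈ maximalIdeal R, I ≤ Ideal.span {w ^ b} ⊔ maximalIdeal R ^ n) :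
    ∃ w ∈ maximalIdeal S, I.map (e : R →+* S) ≤ Ideal.span {w ^ b} ⊔ maximalIdeal S ^ n := by
  obtain ⟨w, hw, hle⟩ := h
  have hmax : (maximalIdeal R).map (e : R →+* S) = maximalIdeal S :=
    IsLocalRing.map_maximalIdeal_of_surjective (e : R →+* S) e.surjective
  refine ⟨e w, ?_, ?_⟩
  · have := Ideal.mem_map_of_mem (e : R →+* S) hw
    rwa [hmax] at this
  · rw [Ideal.map_le_iff_le_comap]
    intro r hr
    obtain ⟨s, hs, q, hq, hsq⟩ := Submodule.mem_sup.mp (hle hr)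
    obtain ⟨c, rfl⟩ := Ideal.mem_span_singleton'.mp hs
    rw [Ideal.mem_comap, ← hsq, map_add, map_mul, map_pow, RingHom.coe_coe]
    refine Submodule.add_mem_sup (Ideal.mul_mem_left _ _ (Ideal.mem_span_singleton_self _)) ?_
    have := Ideal.mem_map_of_mem (e : R →+* S) hq
    rw [Ideal.map_pow, hmax] at this
    exact this

/-- `residualOrder` is invariant under isomorphisms of local rings. [folklore] -/
theorem residualOrder_map_ringEquiv [IsLocalRing R] {S : Type u} [CommRing S] [IsLocalRing S] (b : ℕ) (e : R ≃+* S)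
    (I : Ideal R) : residualOrder b S (I.map (e : R →+* S)) = residualOrder b R I := by
  have key : ∀ n : ℕ, (∃ w ∈ maximalIdeal S, I.map (e : R →+* S) ≤ Ideal.span {w ^ b} ⊔ maximalIdeal S ^ n) ↔
      (∃ w ∈ maximalIdeal R, I ≤ Ideal.span {w ^ b} ⊔ maximalIdeal R ^ n) := by
    intro n
    refine ⟨fun h => ?_, residualOrder_aux b e⟩
    have := residualOrder_aux b e.symm h
    rwa [Ideal.map_of_equiv] at this
  unfold residualOrder
  simp_rw [key]

/-! ## 3. Chart identities of the pulled-back window equation -/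

/-- **Chart `i ∈ {0, 1}`**: if `ψ c_{i'} = ψ c_i · E` and `ψ c₂ = ψ c_i · Z` (the Rees chart relations), then the pulled-back window
equation factors as `ψ(c₂^p + Σ a_k c_i^{d−u_k} c_{i'}^{u_k}) = ψ(c_i)^p · (Z^p + ψ(c_i)^{d−p} · Σ ψ(a_k) E^{u_k})` (`p ≤ d`, `u_k ≤ d`).
[folklore] -/
theorem map_window_eq_chart {L : Type u} [CommRing L] (ψ : R →+* L) {ci ci' c2 : R} {E Z : L} (hE : ψ ci' = ψ ci * E)
    (hZ : ψ c2 = ψ ci * Z) {p d : ℕ} (hpd : p ≤ d) (a : ℕ → R) (u : ℕ → ℕ) (hu : ∀ k, u k ≤ d) :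
    ψ (c2 ^ p + ∑ k ∈ Finset.range (d + 1), a k * ci ^ (d - u k) * ci' ^ (u k)) =
      ψ ci ^ p * (Z ^ p + ψ ci ^ (d - p) * ∑ k ∈ Finset.range (d + 1), ψ (a k) * E ^ (u k)) := by
  rw [map_add, map_pow, hZ, mul_pow, map_sum, mul_add, Finset.mul_sum, Finset.mul_sum]
  congr 1
  refine Finset.sum_congr rfl fun k _ => ?_
  rw [map_mul, map_mul, map_pow, map_pow, hE, mul_pow]
  have h1 : ψ ci ^ (d - u k) * ψ ci ^ (u k) = ψ ci ^ p * ψ ci ^ (d - p) := by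
    rw [← pow_add, ← pow_add, Nat.sub_add_cancel (hu k), Nat.add_sub_cancel' hpd]
  calc ψ (a k) * ψ ci ^ (d - u k) * (ψ ci ^ u k * E ^ u k)
      = ψ (a k) * (ψ ci ^ (d - u k) * ψ ci ^ (u k)) * E ^ (u k) := by ring
    _ = ψ (a k) * (ψ ci ^ p * ψ ci ^ (d - p)) * E ^ (u k) := by rw [h1]
    _ = ψ ci ^ p * (ψ ci ^ (d - p) * (ψ (a k) * E ^ u k)) := by ring

/-- **Chart `2`** (the letter `z` itself): if `ψ c₀ = ψ c₂ · E₀` and `ψ c₁ = ψ c₂ · E₁`, then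
`ψ(c₂^p + Σ a_k c₀^{d−k} c₁^k) = ψ(c₂)^p · (1 + ψ(c₂)^{d−p} · Σ ψ(a_k) E₀^{d−k} E₁^k)`. [folklore] -/
theorem map_window_eq_chart_two {L : Type u} [CommRing L] (ψ : R →+* L) {c0 c1 c2 : R} {E₀ E₁ : L}
    (h0 : ψ c0 = ψ c2 * E₀) (h1 : ψ c1 = ψ c2 * E₁) {p d : ℕ} (hpd : p ≤ d) (a : ℕ → R) :
    ψ (c2 ^ p + ∑ k ∈ Finset.range (d + 1), a k * c0 ^ (d - k) * c1 ^ k) =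
      ψ c2 ^ p * (1 + ψ c2 ^ (d - p) * ∑ k ∈ Finset.range (d + 1), ψ (a k) * E₀ ^ (d - k) * E₁ ^ k) := by
  rw [map_add, map_pow, map_sum, mul_add, mul_one, Finset.mul_sum, Finset.mul_sum]
  congr 1
  refine Finset.sum_congr rfl fun k hk => ?_
  have hkd : k ≤ d := Nat.lt_succ_iff.mp (Finset.mem_range.mp hk)
  rw [map_mul, map_mul, map_pow, map_pow, h0, h1, mul_pow, mul_pow]
  have h2 : ψ c2 ^ (d - k) * ψ c2 ^ k = ψ c2 ^ p * ψ c2 ^ (d - p) := by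
    rw [← pow_add, ← pow_add, Nat.sub_add_cancel hkd, Nat.add_sub_cancel' hpd]
  calc ψ (a k) * (ψ c2 ^ (d - k) * E₀ ^ (d - k)) * (ψ c2 ^ k * E₁ ^ k)
      = ψ (a k) * (ψ c2 ^ (d - k) * ψ c2 ^ k) * E₀ ^ (d - k) * E₁ ^ k := by ring
    _ = ψ (a k) * (ψ c2 ^ p * ψ c2 ^ (d - p)) * E₀ ^ (d - k) * E₁ ^ k := by rw [h2]
    _ = ψ c2 ^ p * (ψ c2 ^ (d - p) * (ψ (a k) * E₀ ^ (d - k) * E₁ ^ k)) := by ring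

/-- In the chart of `z` the cofactor `1 + ψ(c₂)^{d−p} · S` is a unit as soon as `ψ c₂ ∈ 𝔪_L` and `p < d`. [folklore] -/
theorem isUnit_chart_two_cofactor {L : Type u} [CommRing L] [IsLocalRing L] {t S : L} (ht : t ∈ maximalIdeal L)
    {p d : ℕ} (hpd : p < d) : IsUnit (1 + t ^ (d - p) * S) := by
  have hmem : t ^ (d - p) * S ∈ maximalIdeal L :=
    Ideal.mul_mem_right _ _ (Ideal.pow_mem_of_mem _ ht (d - p) (Nat.sub_pos_of_lt hpd))
  by_contra h
  have h1 : (1 : L) + t ^ (d - p) * S ∈ maximalIdeal L := (IsLocalRing.mem_maximalIdeal _).mpr (mem_nonunits_iff.mpr h)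
  have : (1 : L) ∈ maximalIdeal L := by
    have := Ideal.sub_mem _ h1 hmem
    rwa [add_sub_cancel_right] at this
  exact (maximalIdeal.isMaximal L).ne_top ((Ideal.eq_top_iff_one _).mpr this)

/-- **The colon `((t^b · g) : (t)^b) = (g)`** for a non-zero-divisor `t` (the stalk of the controlled transform at a point of a
chart: exceptional equation `t`, pulled-back equation `t^b · g`). [folklore] -/
theorem colon_span_pow_mul {L : Type u} [CommRing L] {t : L} (ht : t ∈ nonZeroDivisors L) (b : ℕ) (g : L) :
    Submodule.colon (Ideal.span {t ^ b * g}) ((Ideal.span {t} ^ b : Ideal L) : Set L) = Ideal.span {g} := by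
  have htb : t ^ b ∈ nonZeroDivisors L := pow_mem ht b
  apply le_antisymm
  · intro y hy
    rw [Submodule.mem_colon] at hy
    have h1 : y • t ^ b ∈ Ideal.span {t ^ b * g} :=
      hy (t ^ b) (by rw [Ideal.span_singleton_pow]; exact Ideal.mem_span_singleton_self _)
    rw [smul_eq_mul, Ideal.mem_span_singleton'] at h1
    obtain ⟨r, hr⟩ := h1
    have : t ^ b * (y - r * g) = 0 := by
      have : r * (t ^ b * g) = y * t ^ b := hr
      linear_combination (-1 : L) * this
    have hy' : y - r * g = 0 := (mem_nonZeroDivisors_iff.mp htb).1 _ this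
    rw [sub_eq_zero] at hy'
    rw [hy']
    exact Ideal.mul_mem_left _ _ (Ideal.mem_span_singleton_self _)
  · intro y hy
    obtain ⟨r, rfl⟩ := Ideal.mem_span_singleton'.mp hy
    rw [Submodule.mem_colon]
    intro s hs
    rw [Ideal.span_singleton_pow, SetLike.mem_coe, Ideal.mem_span_singleton'] at hs
    obtain ⟨s', rfl⟩ := hs
    rw [smul_eq_mul]
    have : r * g * (s' * t ^ b) = (r * s') * (t ^ b * g) := by ring
    rw [this]
    exact Ideal.mul_mem_left _ _ (Ideal.mem_span_singleton_self _)

end Summit.ResolutionOfSingularities.ResolutionOfSingularities.Theorems.CampaignW46.MohWindowSurface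

end
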